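import Summits.KontsevichZagierPeriods.KontsevichZagierPeriods.Theses.SymplecticScissors
import Summits.KontsevichZagierPeriods.KontsevichZagierPeriods.Theorems.SymplecticScissorsPlanarCompilerStubElementaryMovesAux

/-!
# `PlanarCompiler`, stub `stub_elementaryMoves` — helper file II: shears, stacking, additivity of subgraphs

Crux stmt-KontsevichZagierPeriods-10058 (route SymplecticScissors), line `twist-restoring-shear`.
Over an OPEN `ℚ`-semialgebraic subset `U` of the line:

* `exists_shear`: the vertical shear `(x, y) ↦ (x, y − u x)` by a differentiable `ℚ`-semialgebraic
  `u` carries an integrand-`1` representation on the open band `{x ∈ U, a x < y < b x}` to one on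
  `{x ∈ U, a x − u x < y < b x − u x}`, within the planar set-chain group `G` (one rule-2 instance,
  `|det| = 1`);
* `stack_sub_sub_mem_planarGroup`: for `a ≤ b ≤ c` the band of `(a, c)` is the union of the bands
  of `(a, b)` and `(b, c)` and the null graph of `b` (one cut);
* `exists_add_band`: hence the open subgraph of `g + h` (`g, h ≥ 0`, `g` differentiable) is
  congruent modulo `G` to the sum of the subgraphs of `g` and `h`;
* positive parts of `ℚ`-semialgebraic functions are `ℚ`-semialgebraic.

Registered sub-goal: `stub_elementaryMoves_addBand` (= `exists_add_band`).
-/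

noncomputable section

open MeasureTheory Set
open Literature.NumberTheory.Transcendental Literature.ModelTheory.ExponentialFields
open Summit.KontsevichZagierPeriods.KontsevichZagierPeriods.Theses.SymplecticScissors
open Summit.KontsevichZagierPeriods.SymplecticScissors.PlanarK0InjectiveNegative
open Summit.KontsevichZagierPeriods.PlanarAreas.Negative (volume_lt_top_of_integrand_one)

namespace Summit.KontsevichZagierPeriods.SymplecticScissors.PlanarCompilerProof.ElementaryMoves

/-! ## The vertical shear -/

/-- **The vertical shear is a planar rule-2 instance.** For `U` open in the line, `u`
`ℚ`-semialgebraic and differentiable on `U`, the map `(x, y) ↦ (x, y − u x)` carries an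
integrand-`1` representation on the open band `{x ∈ U, a x < y < b x}` onto an integrand-`1`
representation on the band `{x ∈ U, a' x < y < b' x}`, `a' = a − u`, `b' = b − u`, and the two differ
by an element of `G` (Jacobian `[[1, 0], [−u', 1]]`, determinant `1`). [Kontsevich–Zagier 2001, §1.2, rule (2)] -/
theorem exists_shear {U : Set (Fin 1 → ℝ)} (hUo : IsOpen U) {u a b a' b' : (Fin 1 → ℝ) → ℝ}
    (hu : IsSemialgebraicFunOn ℚ U u) (hud : DifferentiableOn ℝ u U)
    (ha' : ∀ x ∈ U, a' x = a x - u x) (hb' : ∀ x ∈ U, b' x = b x - u x)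
    (r : KZ.IntegralRep 2) (hr : ∀ p ∈ r.domain, r.integrand p = 1)
    (hrd : r.domain = {p : Fin 2 → ℝ | (fun _ : Fin 1 => p 0) ∈ U ∧ a (fun _ : Fin 1 => p 0) < p 1 ∧
      p 1 < b (fun _ : Fin 1 => p 0)}) :
    ∃ r' : KZ.IntegralRep 2, r'.domain = {p : Fin 2 → ℝ | (fun _ : Fin 1 => p 0) ∈ U ∧
      a' (fun _ : Fin 1 => p 0) < p 1 ∧ p 1 < b' (fun _ : Fin 1 => p 0)} ∧
      (r'.integrand = fun _ => 1) ∧ KZ.of r - KZ.of r' ∈ planarGroup := by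
  have hdomS : IsSemialgebraic ℚ r.domain := r.isSemialgebraic_domain
  have hsub : r.domain ⊆ {p : Fin 2 → ℝ | (fun _ : Fin 1 => p 0) ∈ U} := by
    rw [hrd]; exact band_subset_cyl U a b
  -- the base map and the shear
  let bL : (Fin 2 → ℝ) →L[ℝ] (Fin 1 → ℝ) :=
    ContinuousLinearMap.pi fun _ : Fin 1 => ContinuousLinearMap.proj (0 : Fin 2)
  have hbL : ∀ p : Fin 2 → ℝ, bL p = fun _ : Fin 1 => p 0 := fun p => rfl
  set Ψ : (Fin 2 → ℝ) → (Fin 2 → ℝ) := fun p => ![p 0, p 1 - u (fun _ : Fin 1 => p 0)] with hΨ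
  let row : (Fin 2 → ℝ) → (Fin 2 → ℝ) →L[ℝ] ℝ := fun p =>
    ContinuousLinearMap.proj (1 : Fin 2) - (fderiv ℝ u (fun _ : Fin 1 => p 0)).comp bL
  let Ψ' : (Fin 2 → ℝ) → (Fin 2 → ℝ) →L[ℝ] (Fin 2 → ℝ) := fun p =>
    ContinuousLinearMap.id ℝ (Fin 2 → ℝ) -
      ((fderiv ℝ u (fun _ : Fin 1 => p 0)).comp bL).smulRight (Pi.single 1 1)
  have hΨ' : ∀ p w : Fin 2 → ℝ, Ψ' p w =
      ![w 0, w 1 - fderiv ℝ u (fun _ : Fin 1 => p 0) (fun _ : Fin 1 => w 0)] := by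
    intro p w
    funext i
    fin_cases i <;> simp [Ψ', hbL]
  -- determinant
  have hdet : ∀ p, (Ψ' p).det = 1 := by
    intro p
    have h := LinearMap.det_toMatrix' (Ψ' p : (Fin 2 → ℝ) →ₗ[ℝ] (Fin 2 → ℝ))
    rw [Matrix.det_fin_two] at h
    simp only [LinearMap.toMatrix'_apply, ContinuousLinearMap.coe_coe, hΨ'] at h
    show LinearMap.det (Ψ' p : (Fin 2 → ℝ) →ₗ[ℝ] (Fin 2 → ℝ)) = 1
    rw [← h]
    simp
    exact ContinuousLinearMap.map_zero _
  -- derivative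
  have hderiv : ∀ p : Fin 2 → ℝ, (fun _ : Fin 1 => p 0) ∈ U → HasFDerivAt Ψ (Ψ' p) p := by
    intro p hp
    rw [hasFDerivAt_pi']
    intro i
    fin_cases i
    · have hfun : (fun x => Ψ x 0) = fun x : Fin 2 → ℝ => x 0 := by funext x; simp [hΨ]
      show HasFDerivAt (fun x => Ψ x 0) _ p
      rw [hfun]
      refine (hasFDerivAt_apply (0 : Fin 2) p).congr_fderiv (ContinuousLinearMap.ext fun w => ?_)
      simp [hΨ']
    · have hb : HasFDerivAt (fun x : Fin 2 → ℝ => (fun _ : Fin 1 => x 0)) bL p := by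
        have := bL.hasFDerivAt (x := p)
        exact this
      have hux : HasFDerivAt u (fderiv ℝ u (fun _ : Fin 1 => p 0)) (fun _ : Fin 1 => p 0) :=
        ((hud _ hp).differentiableAt (hUo.mem_nhds hp)).hasFDerivAt
      have hcomp := hux.comp p hb
      have h1 : HasFDerivAt (fun x : Fin 2 → ℝ => x 1)
          (ContinuousLinearMap.proj (R := ℝ) (φ := fun _ : Fin 2 => ℝ) (1 : Fin 2)) p :=
        hasFDerivAt_apply (1 : Fin 2) p
      have h := h1.sub hcomp
      have hfun : (fun x => Ψ x 1) =
          fun x : Fin 2 → ℝ => x 1 - (u ∘ fun x : Fin 2 → ℝ => (fun _ : Fin 1 => x 0)) x := by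
        funext x; simp [hΨ]
      show HasFDerivAt (fun x => Ψ x 1) _ p
      rw [hfun]
      refine h.congr_fderiv (ContinuousLinearMap.ext fun w => ?_)
      simp [hΨ', hbL]
  -- semialgebraicity
  have hui : IsSemialgebraicFunOn ℚ r.domain (fun p => u (fun _ : Fin 1 => p 0)) :=
    isSemialgebraicFunOn_base hu hdomS hsub
  have hmap : IsSemialgebraicMapOn ℚ r.domain Ψ := by
    refine IsSemialgebraicMapOn.of_forall hdomS fun j => ?_
    fin_cases j
    · exact (isSemialgebraicFunOn_apply hdomS (0 : Fin 2)).congr fun p _ => by simp [hΨ]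
    · exact (IsSemialgebraicFunOn.sub_holds (isSemialgebraicFunOn_apply hdomS (1 : Fin 2)) hui).congr
        fun p _ => by simp [hΨ]
  -- injectivity
  have hinj : InjOn Ψ r.domain := by
    intro p _ q _ hpq
    have h0 : p 0 = q 0 := by
      have := congr_fun hpq 0
      simpa [hΨ] using this
    have h1 : p 1 - u (fun _ : Fin 1 => p 0) = q 1 - u (fun _ : Fin 1 => q 0) := by
      have := congr_fun hpq 1
      simpa [hΨ] using this
    rw [h0] at h1
    have h1' : p 1 = q 1 := by linarith
    rw [eq_vec p, eq_vec q, h0, h1']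
  -- image
  have himage : Ψ '' r.domain = {p : Fin 2 → ℝ | (fun _ : Fin 1 => p 0) ∈ U ∧
      a' (fun _ : Fin 1 => p 0) < p 1 ∧ p 1 < b' (fun _ : Fin 1 => p 0)} := by
    rw [hrd]
    ext q
    simp only [mem_image, mem_setOf_eq]
    constructor
    · rintro ⟨p, ⟨hpU, hpa, hpb⟩, rfl⟩
      simp only [hΨ, Matrix.cons_val_zero, Matrix.cons_val_one, Matrix.cons_val_fin_one]
      refine ⟨hpU, ?_, ?_⟩
      · rw [ha' _ hpU]; linarith
      · rw [hb' _ hpU]; linarith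
    · rintro ⟨hqU, hqa, hqb⟩
      refine ⟨![q 0, q 1 + u (fun _ : Fin 1 => q 0)], ⟨?_, ?_, ?_⟩, ?_⟩
      · simpa using hqU
      · simp only [Matrix.cons_val_zero, Matrix.cons_val_one, Matrix.cons_val_fin_one]
        rw [ha' _ hqU] at hqa; linarith
      · simp only [Matrix.cons_val_zero, Matrix.cons_val_one, Matrix.cons_val_fin_one]
        rw [hb' _ hqU] at hqb; linarith
      · simp only [hΨ, Matrix.cons_val_zero, Matrix.cons_val_one, Matrix.cons_val_fin_one,
          add_sub_cancel_right]
        exact (eq_vec q).symm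
  have hd : ∀ p ∈ r.domain, HasFDerivWithinAt Ψ (Ψ' p) r.domain p :=
    fun p hp => (hderiv p (hsub hp)).hasFDerivWithinAt
  have hdet' : ∀ p ∈ r.domain, |(Ψ' p).det| = 1 := fun p _ => by rw [hdet p, abs_one]
  obtain ⟨r', hr'd, hr'i⟩ := exists_rep_image r hr hmap hd hinj hdet'
  have hr'1 : ∀ p ∈ r'.domain, r'.integrand p = 1 := fun p _ => by rw [hr'i]
  exact ⟨r', hr'd.trans himage, hr'i,
    sub_mem_planarGroup_of_map r r' hr hr'1 hmap hd hinj hdet' hr'd⟩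

/-! ## Stacking bands -/

/-- **Stacking**: for `a ≤ b ≤ c` on `P` (with `b` `ℚ`-semialgebraic), the open band of `(a, c)`
is the disjoint union of the open bands of `(a, b)`, `(b, c)` and the null graph of `b`, so the
corresponding integrand-`1` representations satisfy `[ac] − [ab] − [bc] ∈ G`. [Kontsevich–Zagier 2001, §1.2, rule (1)] -/
theorem stack_sub_sub_mem_planarGroup {P : Set (Fin 1 → ℝ)} {a b c : (Fin 1 → ℝ) → ℝ}
    (hb : IsSemialgebraicFunOn ℚ P b) (hle : ∀ x ∈ P, a x ≤ b x ∧ b x ≤ c x)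
    (rac rab rbc : KZ.IntegralRep 2) (hac : ∀ p ∈ rac.domain, rac.integrand p = 1)
    (hab : ∀ p ∈ rab.domain, rab.integrand p = 1) (hbc : ∀ p ∈ rbc.domain, rbc.integrand p = 1)
    (hacd : rac.domain = {p : Fin 2 → ℝ | (fun _ : Fin 1 => p 0) ∈ P ∧ a (fun _ : Fin 1 => p 0) < p 1 ∧
      p 1 < c (fun _ : Fin 1 => p 0)})
    (habd : rab.domain = {p : Fin 2 → ℝ | (fun _ : Fin 1 => p 0) ∈ P ∧ a (fun _ : Fin 1 => p 0) < p 1 ∧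
      p 1 < b (fun _ : Fin 1 => p 0)})
    (hbcd : rbc.domain = {p : Fin 2 → ℝ | (fun _ : Fin 1 => p 0) ∈ P ∧ b (fun _ : Fin 1 => p 0) < p 1 ∧
      p 1 < c (fun _ : Fin 1 => p 0)}) :
    KZ.of rac - KZ.of rab - KZ.of rbc ∈ planarGroup := by
  have hS : IsSemialgebraic ℚ (rab.domain ∪ rbc.domain) :=
    rab.isSemialgebraic_domain.union rbc.isSemialgebraic_domain
  have hsub : rab.domain ∪ rbc.domain ⊆ rac.domain := by
    rw [habd, hbcd, hacd]
    rintro p (⟨hx, h1, h2⟩ | ⟨hx, h1, h2⟩)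
    · exact ⟨hx, h1, h2.trans_le (hle _ hx).2⟩
    · exact ⟨hx, (hle _ hx).1.trans_lt h1, h2⟩
  have hfin : volume (rab.domain ∪ rbc.domain) ≠ ⊤ :=
    ((measure_mono hsub).trans_lt (volume_lt_top_of_integrand_one rac hac)).ne
  obtain ⟨r', hr'd, hr'i⟩ := KZ.exists_oneRep hS hfin
  have hr'1 : ∀ p ∈ r'.domain, r'.integrand p = 1 := fun p _ => by rw [hr'i]
  have hdisj : rab.domain ∩ rbc.domain = ∅ := by
    rw [habd, hbcd]
    ext p
    simp only [mem_inter_iff, mem_setOf_eq, mem_empty_iff_false, iff_false, not_and, not_lt]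
    intro hp _ h3
    linarith [hp.2.2]
  have hcut : KZ.of r' - KZ.of rab - KZ.of rbc ∈ planarGroup :=
    cut_mem_planarGroup r' rab rbc hr'1 hab hbc hr'd (by rw [hdisj, measure_empty])
  have hnull : KZ.of rac - KZ.of r' ∈ planarGroup := by
    refine sub_mem_planarGroup_of_subset rac r' hac hr'1 (hr'd ▸ hsub) ?_
    refine measure_mono_null ?_ (volume_graph_eq_zero hb)
    rw [hr'd, hacd, habd, hbcd]
    rintro p ⟨⟨hx, h1, h2⟩, hp⟩
    simp only [mem_union, mem_setOf_eq, not_or, not_and, not_lt] at hp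
    refine ⟨hx, le_antisymm ?_ (hp.1 hx h1)⟩
    by_contra h
    exact absurd h2 (not_lt.mpr (hp.2 hx (not_le.mp h)))
  have : KZ.of rac - KZ.of rab - KZ.of rbc = (KZ.of rac - KZ.of r') + (KZ.of r' - KZ.of rab - KZ.of rbc) := by
    abel
  rw [this]
  exact add_mem hnull hcut

/-! ## Additivity of open subgraphs -/

/-- **Additivity of open subgraphs.** For `U` open in the line, `g, h ≥ 0` `ℚ`-semialgebraic on `U`
with `g` differentiable, and integrand-`1` representations `r_g`, `r_h` on the open subgraphs
`{x ∈ U, 0 < y < g x}`, `{x ∈ U, 0 < y < h x}`, there is an integrand-`1` representation `r` on the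
open subgraph of `g + h` with `[r] − [r_g] − [r_h] ∈ G`: shear the subgraph of `h` onto the band
`{g < y < g + h}` and stack. [Kontsevich–Zagier 2001, §1.2] -/
theorem exists_add_band {U : Set (Fin 1 → ℝ)} (hUo : IsOpen U) {g h : (Fin 1 → ℝ) → ℝ}
    (hg : IsSemialgebraicFunOn ℚ U g) (hgd : DifferentiableOn ℝ g U) (hh : IsSemialgebraicFunOn ℚ U h)
    (hg0 : ∀ x ∈ U, 0 ≤ g x) (hh0 : ∀ x ∈ U, 0 ≤ h x)
    (rg rh : KZ.IntegralRep 2) (hrg : ∀ p ∈ rg.domain, rg.integrand p = 1)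
    (hrh : ∀ p ∈ rh.domain, rh.integrand p = 1)
    (hrgd : rg.domain = {p : Fin 2 → ℝ | (fun _ : Fin 1 => p 0) ∈ U ∧ 0 < p 1 ∧
      p 1 < g (fun _ : Fin 1 => p 0)})
    (hrhd : rh.domain = {p : Fin 2 → ℝ | (fun _ : Fin 1 => p 0) ∈ U ∧ 0 < p 1 ∧
      p 1 < h (fun _ : Fin 1 => p 0)}) :
    ∃ r : KZ.IntegralRep 2, r.domain = {p : Fin 2 → ℝ | (fun _ : Fin 1 => p 0) ∈ U ∧ 0 < p 1 ∧
      p 1 < g (fun _ : Fin 1 => p 0) + h (fun _ : Fin 1 => p 0)} ∧ (r.integrand = fun _ => 1) ∧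
      KZ.of r - KZ.of rg - KZ.of rh ∈ planarGroup := by
  have hU : IsSemialgebraic ℚ U := IsSemialgebraicFunOn.isSemialgebraic_holds hg
  -- shear the subgraph of `h` by `-g`
  obtain ⟨rs, hrsd, hrsi, hrs⟩ := exists_shear hUo (u := fun x => -g x) (a := fun _ => 0) (b := h)
    (a' := g) (b' := fun x => g x + h x) hg.neg hgd.neg (fun x _ => by ring) (fun x _ => by ring)
    rh hrh hrhd
  have hrs1 : ∀ p ∈ rs.domain, rs.integrand p = 1 := fun p _ => by rw [hrsi]
  -- the subgraph of `g + h`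
  have hgh : IsSemialgebraicFunOn ℚ U (fun x => g x + h x) := IsSemialgebraicFunOn.add_holds hg hh
  have hS : IsSemialgebraic ℚ {p : Fin 2 → ℝ | (fun _ : Fin 1 => p 0) ∈ U ∧
      (fun _ => (0 : ℝ)) (fun _ : Fin 1 => p 0) < p 1 ∧ p 1 < g (fun _ : Fin 1 => p 0) + h (fun _ : Fin 1 => p 0)} :=
    isSemialgebraic_band (a := fun _ => (0 : ℝ))
      ((isSemialgebraicFunOn_aeval hU 0).congr fun x _ => by simp) hgh
  have hcover : {p : Fin 2 → ℝ | (fun _ : Fin 1 => p 0) ∈ U ∧ (fun _ => (0 : ℝ)) (fun _ : Fin 1 => p 0) < p 1 ∧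
      p 1 < g (fun _ : Fin 1 => p 0) + h (fun _ : Fin 1 => p 0)} ⊆ (rg.domain ∪ rs.domain) ∪
      {p : Fin 2 → ℝ | (fun _ : Fin 1 => p 0) ∈ U ∧ p 1 = g (fun _ : Fin 1 => p 0)} := by
    rw [hrgd, hrsd]
    rintro p ⟨hx, h1, h2⟩
    rcases lt_trichotomy (p 1) (g (fun _ : Fin 1 => p 0)) with hlt | heq | hgt
    · exact Or.inl (Or.inl ⟨hx, h1, hlt⟩)
    · exact Or.inr ⟨hx, heq⟩
    · exact Or.inl (Or.inr ⟨hx, hgt, h2⟩)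
  have hfin : volume {p : Fin 2 → ℝ | (fun _ : Fin 1 => p 0) ∈ U ∧ (fun _ => (0 : ℝ)) (fun _ : Fin 1 => p 0) < p 1 ∧
      p 1 < g (fun _ : Fin 1 => p 0) + h (fun _ : Fin 1 => p 0)} ≠ ⊤ := by
    refine ((measure_mono hcover).trans_lt ?_).ne
    refine measure_union_lt_top (measure_union_lt_top (volume_lt_top_of_integrand_one rg hrg)
      (volume_lt_top_of_integrand_one rs hrs1)) ?_
    rw [volume_graph_eq_zero hg]
    exact ENNReal.zero_lt_top
  obtain ⟨r, hrd, hri⟩ := KZ.exists_oneRep hS hfin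
  have hr1 : ∀ p ∈ r.domain, r.integrand p = 1 := fun p _ => by rw [hri]
  have hstack := stack_sub_sub_mem_planarGroup (P := U) (a := fun _ => 0) (b := g)
    (c := fun x => g x + h x) hg (fun x hx => ⟨hg0 x hx, by linarith [hh0 x hx]⟩) r rg rs hr1 hrg hrs1
    hrd hrgd hrsd
  refine ⟨r, hrd, hri, ?_⟩
  have : KZ.of r - KZ.of rg - KZ.of rh = (KZ.of r - KZ.of rg - KZ.of rs) - (KZ.of rh - KZ.of rs) := by
    abel
  rw [this]
  exact sub_mem hstack hrs

/-! ## Positive parts -/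

/-- The positive part `x ↦ max (f x) 0` of a `ℚ`-semialgebraic function is `ℚ`-semialgebraic
(glue `f` on `{f ≥ 0}` and `0` on `{f < 0}`). [folklore] -/
theorem isSemialgebraicFunOn_posPart {m : ℕ} {s : Set (Fin m → ℝ)} {f : (Fin m → ℝ) → ℝ}
    (hf : IsSemialgebraicFunOn ℚ s f) : IsSemialgebraicFunOn ℚ s (fun x => max (f x) 0) := by
  have hs : IsSemialgebraic ℚ s := IsSemialgebraicFunOn.isSemialgebraic_holds hf
  have hp : IsSemialgebraic ℚ {x | x ∈ s ∧ 0 ≤ f x} := hf.isSemialgebraic_sep_nonneg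
  have hn : IsSemialgebraic ℚ {x | x ∈ s ∧ f x < 0} := hf.isSemialgebraic_sep_neg
  have h1 : IsSemialgebraicFunOn ℚ {x | x ∈ s ∧ 0 ≤ f x} f := hf.mono (fun x hx => hx.1) hp
  have h2 : IsSemialgebraicFunOn ℚ {x | x ∈ s ∧ f x < 0} (fun _ => (0 : ℝ)) :=
    (isSemialgebraicFunOn_aeval hn 0).congr fun x _ => by simp
  have hst : {x | x ∈ s ∧ 0 ≤ f x} ∪ {x | x ∈ s ∧ f x < 0} = s := by
    ext x
    simp only [mem_union, mem_setOf_eq]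
    constructor
    · rintro (h | h) <;> exact h.1
    · intro hx
      rcases le_or_gt 0 (f x) with h | h
      · exact Or.inl ⟨hx, h⟩
      · exact Or.inr ⟨hx, h⟩
  rw [← hst]
  exact IsSemialgebraicFunOn.union h1 h2 (fun x hx => max_eq_left hx.2) (fun x hx => max_eq_right hx.2.le)

/-- The negative part `x ↦ max (-f x) 0` of a `ℚ`-semialgebraic function is `ℚ`-semialgebraic.
[folklore] -/
theorem isSemialgebraicFunOn_negPart {m : ℕ} {s : Set (Fin m → ℝ)} {f : (Fin m → ℝ) → ℝ}
    (hf : IsSemialgebraicFunOn ℚ s f) : IsSemialgebraicFunOn ℚ s (fun x => max (-f x) 0) :=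
  isSemialgebraicFunOn_posPart hf.neg

/-- The open subgraph of `f` is the open subgraph of its positive part. [folklore] -/
theorem band_eq_band_posPart (P : Set (Fin 1 → ℝ)) (f : (Fin 1 → ℝ) → ℝ) :
    {p : Fin 2 → ℝ | (fun _ : Fin 1 => p 0) ∈ P ∧ 0 < p 1 ∧ p 1 < f (fun _ : Fin 1 => p 0)} =
    {p : Fin 2 → ℝ | (fun _ : Fin 1 => p 0) ∈ P ∧ 0 < p 1 ∧ p 1 < max (f (fun _ : Fin 1 => p 0)) 0} := by
  ext p
  simp only [mem_setOf_eq, lt_max_iff]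
  constructor
  · rintro ⟨hx, h1, h2⟩
    exact ⟨hx, h1, Or.inl h2⟩
  · rintro ⟨hx, h1, h2 | h2⟩
    · exact ⟨hx, h1, h2⟩
    · exact absurd (h1.trans h2) (lt_irrefl _)

end Summit.KontsevichZagierPeriods.SymplecticScissors.PlanarCompilerProof.ElementaryMoves

namespace Summit.KontsevichZagierPeriods.SymplecticScissors.PlanarCompilerProof

/-- **Registered sub-goal of `stub_elementaryMoves` (file II): additivity of open subgraphs.** For
`U` open in the line and `g, h ≥ 0` `ℚ`-semialgebraic on `U` with `g` differentiable, the open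
subgraph of `g + h` carries an integrand-`1` representation congruent, modulo the planar set-chain
group, to the sum of integrand-`1` representations on the open subgraphs of `g` and `h`.
[Kontsevich–Zagier 2001, §1.2, rules (1), (2)] -/
theorem stub_elementaryMoves_addBand : ∀ (U : Set (Fin 1 → ℝ)) (g h : (Fin 1 → ℝ) → ℝ), IsOpen U → IsSemialgebraicFunOn ℚ U g → DifferentiableOn ℝ g U → IsSemialgebraicFunOn ℚ U h → (∀ x ∈ U, 0 ≤ g x) → (∀ x ∈ U, 0 ≤ h x) → ∀ (rg rh : KZ.IntegralRep 2), (∀ p ∈ rg.domain, rg.integrand p = 1) → (∀ p ∈ rh.domain, rh.integrand p = 1) → rg.domain = {p : Fin 2 → ℝ | (fun _ : Fin 1 => p 0) ∈ U ∧ 0 < p 1 ∧ p 1 < g (fun _ : Fin 1 => p 0)} → rh.domain = {p : Fin 2 → ℝ | (fun _ : Fin 1 => p 0) ∈ U ∧ 0 < p 1 ∧ p 1 < h (fun _ : Fin 1 => p 0)} → ∃ r : KZ.IntegralRep 2, r.domain = {p : Fin 2 → ℝ | (fun _ : Fin 1 => p 0) ∈ U ∧ 0 < p 1 ∧ p 1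 < g (fun _ : Fin 1 => p 0) + h (fun _ : Fin 1 => p 0)} ∧ (r.integrand = fun _ => 1) ∧ KZ.of r - KZ.of rg - KZ.of rh ∈ AddSubgroup.closure ((KZ.domainAddRel ∪ KZ.changeOfVariablesRel) ∩ (AddSubgroup.closure {x : KZ.FormalRep | ∃ s : KZ.IntegralRep 2, (∀ p ∈ s.domain, s.integrand p = 1) ∧ x = KZ.of s} : Set KZ.FormalRep)) :=
  fun _ _ _ hUo hg hgd hh hg0 hh0 rg rh hrg hrh hrgd hrhd =>
    ElementaryMoves.exists_add_band hUo hg hgd hh hg0 hh0 rg rh hrg hrh hrgd hrhd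

end Summit.KontsevichZagierPeriods.SymplecticScissors.PlanarCompilerProof
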